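import Mathlib
import HarnessLib

/-!
# Route `RadicialJung`, crux `CleanModels` (stmt-ResolutionOfSingularities-15917), line `Sketch` rev 35, stub 6 `stub_cleanProp44` (X44c):
# THE WEIGHTED LEAF ORDER DROPS BY AT MOST ONE PER DIVISION — first brick of the tower computation (census (iii-3)), def-free

Seat decomp-res-hand-2 g20 (structural hand).  Memo 4e §2.5 measures an ideal `J` (order `μ`) at a point `c` against a leaf `L = V(t)` by Hironaka's
`δ(c, L) = sup{δ : J ⊆ Σ_{e ≤ μ} 𝓘_L^e · 𝔪_c^{⌈(μ−e)δ⌉}}` (census item (iii-1): NOT a definition of the tree) and follows it along the tower of divisions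
«chart `u₁`: `t = t_j u₁^j`, `J_j = J·u₁^{−jμ}` after `j` divisions».  The one-step bookkeeping is monomial: `t^e u^{(a,b)}` with `a + b ≥ (μ−e)δ` becomes
`t₁^e u₁^{e+a+b−μ} u₂′^b` with `e + a + b − μ ≥ (μ − e)(δ − 1)`.  THIS FILE types that step for ARBITRARY weights, with no definition: for a ring map
`ψ : R → A` (the chart / the local ring upstairs) with `ψ(𝔪) A ⊆ (v)` (`v` the exceptional parameter, a non-zero-divisor) and `ψ t = v·t₁` (`t₁` the strict
transform of the leaf),

* `map_le_span_pow_mul_sum_of_le_sum` — `J ⊆ Σ_{e ≤ μ} (t^e)·𝔪^{n_e}` with `e + n_e ≥ μ` ⟹ `ψ(J) A ⊆ (v^μ) · Σ_{e ≤ μ} (t₁^e)·(v)^{e + n_e − μ}`;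
* `mem_sum_of_pow_mul_mem_map` — **ONE DIVISION**: hence every `x` with `v^μ x ∈ ψ(J) A` (i.e. every element of the controlled transform
  `J₁ = (ψ(J)A : v^μ)`) lies in `Σ_{e ≤ μ} (t₁^e)·(v)^{e + n_e − μ}`.  With `n_e = ⌈(μ−e)δ⌉` (`δ ≥ 1`) the new weights are `≥ ⌈(μ−e)(δ−1)⌉`:
  «`δ` drops by at most one per division», at the closed point as at the generic point of `Z₀ = E ∩ L̃` (where `u₂′` is a unit).

Honest framing: OURS, elementary monomial bookkeeping; the converse inequality, the `δ`-face and the identification of the successor `Γ″` (memo §2.5) are NOT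
addressed; nothing here proves X44c, any case of `CleanModels`, or resolution of singularities in characteristic `p`.
[cite: CossartPiltant2008, Prop. 4.4 (proof, p. 11)] [cite: CossartJannsenSaito2020, Def. 7.1 (δ-invariant), Lemma 7.5]
-/

noncomputable section

set_option linter.dupNamespace false -- mandated namespace of this single-conjunct summit

namespace Summit.ResolutionOfSingularities.ResolutionOfSingularities.Theorems.RadicialJung.CleanModels

variable {R A : Type*} [CommRing R] [CommRing A] (ψ : R →+* A)

/-- `Ideal.map` commutes with finite sums of ideals. [folklore] -/
theorem map_finset_sum {ι : Type*} (s : Finset ι) (I : ι → Ideal R) : (∑ i ∈ s, I i).map ψ = ∑ i ∈ s, (I i).map ψ := by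
  classical
  induction s using Finset.induction_on with
  | empty => simp [Ideal.map_bot]
  | insert i s hi ih => rw [Finset.sum_insert hi, Finset.sum_insert hi, Ideal.add_eq_sup, Ideal.add_eq_sup, Ideal.map_sup, ih]

/-- One summand: `ψ((t^e)·𝔪^n) A ⊆ (v^μ)·((t₁^e)·(v)^{e+n−μ})` when `ψ(𝔪)A ⊆ (v)`, `ψ t = v t₁`, `μ ≤ e + n`. [folklore] -/
theorem map_span_pow_mul_pow_le (𝔪 : Ideal R) {t : R} {v t₁ : A} (h𝔪 : 𝔪.map ψ ≤ Ideal.span {v}) (ht : ψ t = v * t₁)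
    {μ e n : ℕ} (hn : μ ≤ e + n) :
    (Ideal.span {t ^ e} * 𝔪 ^ n).map ψ ≤ Ideal.span {v ^ μ} * (Ideal.span {t₁ ^ e} * Ideal.span {v} ^ (e + n - μ)) := by
  have hL : (Ideal.span {t ^ e} * 𝔪 ^ n).map ψ ≤ Ideal.span {v ^ e * t₁ ^ e} * Ideal.span {v} ^ n := by
    rw [Ideal.map_mul, Ideal.map_pow, Ideal.map_span, Set.image_singleton, map_pow, ht, mul_pow]
    exact Ideal.mul_mono_right (Ideal.pow_right_mono h𝔪 n)
  have hve : Ideal.span {v ^ e} = Ideal.span {v} ^ e := by rw [Ideal.span_singleton_pow]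
  have hvμ : Ideal.span {v ^ μ} = Ideal.span {v} ^ μ := by rw [Ideal.span_singleton_pow]
  have hR : Ideal.span {v ^ e * t₁ ^ e} * Ideal.span {v} ^ n =
      Ideal.span {v ^ μ} * (Ideal.span {t₁ ^ e} * Ideal.span {v} ^ (e + n - μ)) := by
    rw [← Ideal.span_singleton_mul_span_singleton, hve, hvμ]
    have h3 : Ideal.span {v} ^ e * Ideal.span {v} ^ n = Ideal.span {v} ^ μ * Ideal.span ({v} : Set A) ^ (e + n - μ) := by
      rw [← pow_add, ← pow_add]
      congr 1
      omega
    calc Ideal.span {v} ^ e * Ideal.span {t₁ ^ e} * Ideal.span {v} ^ n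
        = Ideal.span {t₁ ^ e} * (Ideal.span {v} ^ e * Ideal.span {v} ^ n) := by ring
      _ = Ideal.span {t₁ ^ e} * (Ideal.span {v} ^ μ * Ideal.span {v} ^ (e + n - μ)) := by rw [h3]
      _ = Ideal.span {v} ^ μ * (Ideal.span {t₁ ^ e} * Ideal.span {v} ^ (e + n - μ)) := by ring
  exact hL.trans hR.le

/-- **`J ⊆ Σ_{e ≤ μ} (t^e)·𝔪^{n_e}` (`μ ≤ e + n_e`) ⟹ `ψ(J) A ⊆ (v^μ) · Σ_{e ≤ μ} (t₁^e)·(v)^{e + n_e − μ}`.**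
[cite: CossartJannsenSaito2020, Lemma 7.5] -/
theorem map_le_span_pow_mul_sum_of_le_sum (𝔪 : Ideal R) {t : R} {v t₁ : A} (h𝔪 : 𝔪.map ψ ≤ Ideal.span {v}) (ht : ψ t = v * t₁)
    (μ : ℕ) (n : ℕ → ℕ) (hn : ∀ e ≤ μ, μ ≤ e + n e) {J : Ideal R}
    (hJ : J ≤ ∑ e ∈ Finset.range (μ + 1), Ideal.span {t ^ e} * 𝔪 ^ n e) :
    J.map ψ ≤ Ideal.span {v ^ μ} * ∑ e ∈ Finset.range (μ + 1), Ideal.span {t₁ ^ e} * Ideal.span {v} ^ (e + n e - μ) := by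
  refine (Ideal.map_mono hJ).trans ?_
  rw [map_finset_sum, Finset.mul_sum]
  refine Finset.sum_le_sum fun e he => ?_
  exact map_span_pow_mul_pow_le ψ 𝔪 h𝔪 ht (hn e (by simpa [Finset.mem_range, Nat.lt_succ_iff] using he))

/-- **ONE DIVISION: the weighted leaf order drops by at most one.**  With `ψ(𝔪)A ⊆ (v)`, `v` a non-zero-divisor, `ψ t = v·t₁`, and
`J ⊆ Σ_{e ≤ μ} (t^e)·𝔪^{n_e}` (`μ ≤ e + n_e`): every `x ∈ A` with `v^μ·x ∈ ψ(J)A` (every element of the controlled transform `(ψ(J)A : v^μ)`) lies in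
`Σ_{e ≤ μ} (t₁^e)·(v)^{e + n_e − μ}`.  For `n_e = ⌈(μ−e)δ⌉`, `δ ≥ 1`: `e + n_e − μ ≥ ⌈(μ−e)(δ−1)⌉`. [cite: CossartPiltant2008, Prop. 4.4 (proof, p. 11)]
[cite: CossartJannsenSaito2020, Lemma 7.5] -/
theorem mem_sum_of_pow_mul_mem_map (𝔪 : Ideal R) {t : R} {v t₁ : A} (hv : v ∈ nonZeroDivisors A) (h𝔪 : 𝔪.map ψ ≤ Ideal.span {v})
    (ht : ψ t = v * t₁) (μ : ℕ) (n : ℕ → ℕ) (hn : ∀ e ≤ μ, μ ≤ e + n e) {J : Ideal R}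
    (hJ : J ≤ ∑ e ∈ Finset.range (μ + 1), Ideal.span {t ^ e} * 𝔪 ^ n e) {x : A} (hx : v ^ μ * x ∈ J.map ψ) :
    x ∈ ∑ e ∈ Finset.range (μ + 1), Ideal.span {t₁ ^ e} * Ideal.span {v} ^ (e + n e - μ) := by
  have h1 := map_le_span_pow_mul_sum_of_le_sum ψ 𝔪 h𝔪 ht μ n hn hJ hx
  obtain ⟨b, hb, hbx⟩ := Ideal.mem_span_singleton_mul.mp h1
  have hvμ : v ^ μ ∈ nonZeroDivisors A := pow_mem hv μ
  have : x = b := ((mul_cancel_left_mem_nonZeroDivisors hvμ).mp hbx).symm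
  rw [this]; exact hb

/-- The weights: `n_e ≥ (μ − e)·d` (integer `d ≥ 1`, the case `δ = d` of the memo) gives `μ ≤ e + n_e` and new weights `e + n_e − μ ≥ (μ − e)(d − 1)`.
[folklore] -/
theorem weight_after_division {μ e d n : ℕ} (he : e ≤ μ) (hd : 1 ≤ d) (hn : (μ - e) * d ≤ n) :
    μ ≤ e + n ∧ (μ - e) * (d - 1) ≤ e + n - μ := by
  have h1 : (μ - e) * 1 ≤ (μ - e) * d := Nat.mul_le_mul_left _ hd
  rw [mul_one] at h1
  refine ⟨by omega, ?_⟩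
  have h2 : (μ - e) * (d - 1) = (μ - e) * d - (μ - e) := by
    rw [Nat.mul_sub, mul_one]
  omega

/-- Hence, with integer weight `d ≥ 1` («`δ ≥ d`» upstairs): the controlled transform lies in `Σ_{e ≤ μ} (t₁^e)·(v)^{(μ−e)(d−1)}` («`δ ≥ d − 1`» after
one division). [cite: CossartPiltant2008, Prop. 4.4 (proof, p. 11)] [cite: CossartJannsenSaito2020, Lemma 7.5] -/
theorem mem_sum_of_pow_mul_mem_map_of_weight (𝔪 : Ideal R) {t : R} {v t₁ : A} (hv : v ∈ nonZeroDivisors A)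
    (h𝔪 : 𝔪.map ψ ≤ Ideal.span {v}) (ht : ψ t = v * t₁) (μ d : ℕ) (hd : 1 ≤ d) {J : Ideal R}
    (hJ : J ≤ ∑ e ∈ Finset.range (μ + 1), Ideal.span {t ^ e} * 𝔪 ^ ((μ - e) * d)) {x : A} (hx : v ^ μ * x ∈ J.map ψ) :
    x ∈ ∑ e ∈ Finset.range (μ + 1), Ideal.span {t₁ ^ e} * Ideal.span {v} ^ ((μ - e) * (d - 1)) := by
  have hmem := mem_sum_of_pow_mul_mem_map ψ 𝔪 hv h𝔪 ht μ (fun e => (μ - e) * d)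
    (fun e he => (weight_after_division he hd le_rfl).1) hJ hx
  have hle : (∑ e ∈ Finset.range (μ + 1), Ideal.span {t₁ ^ e} * Ideal.span {v} ^ (e + (μ - e) * d - μ)) ≤
      ∑ e ∈ Finset.range (μ + 1), Ideal.span {t₁ ^ e} * Ideal.span {v} ^ ((μ - e) * (d - 1)) := by
    refine Finset.sum_le_sum fun e he => ?_
    have he' : e ≤ μ := by simpa [Finset.mem_range, Nat.lt_succ_iff] using he
    exact Ideal.mul_mono_right (Ideal.pow_le_pow_right (weight_after_division he' hd le_rfl).2)
  exact hle hmem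

/-! ## Appended (hand-2 g20): the nearness criterion «`δ ≥ 2` ⟹ the curve `Z₀ = E ∩ L̃` is near» -/

/-- Each summand `(t₁^e)·(v)^k` lies in `(t₁, v)^{e + k}`. [folklore] -/
theorem span_pow_mul_span_pow_le_span_pair_pow (t₁ v : A) (e k : ℕ) :
    Ideal.span {t₁ ^ e} * Ideal.span {v} ^ k ≤ Ideal.span ({t₁, v} : Set A) ^ (e + k) := by
  rw [← Ideal.span_singleton_pow, pow_add]
  refine Ideal.mul_mono (Ideal.pow_right_mono ?_ e) (Ideal.pow_right_mono ?_ k)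
  · exact Ideal.span_mono (Set.singleton_subset_iff.mpr (Set.mem_insert _ _))
  · exact Ideal.span_mono (Set.singleton_subset_iff.mpr (Set.mem_insert_of_mem _ rfl))

/-- **«`δ ≥ 2` upstairs ⟹ `Z₀` is near»** (memo 4e §2.5 «`Z_j` is near ⟺ `δ ≥ j + 2`», the direction ⟸ for `j = 0`, def-free): if after one division the
controlled transform lies in `Σ_{e ≤ μ} (t₁^e)·(v)^{k_e}` with `μ ≤ e + k_e` for all `e` (e.g. `k_e = (μ−e)(d−1)` with `d ≥ 2`), then it lies in `(t₁, v)^μ`: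
its order along the curve `Z₀ = V(t₁, v)` is `≥ μ`. [cite: CossartPiltant2008, Lemma 4.3 (4); Prop. 4.4 (proof, p. 11)] -/
theorem le_span_pair_pow_of_le_sum {μ : ℕ} (k : ℕ → ℕ) (hk : ∀ e ≤ μ, μ ≤ e + k e) {t₁ v : A} {J₁ : Ideal A}
    (hJ : J₁ ≤ ∑ e ∈ Finset.range (μ + 1), Ideal.span {t₁ ^ e} * Ideal.span {v} ^ k e) :
    J₁ ≤ Ideal.span ({t₁, v} : Set A) ^ μ := by
  refine hJ.trans (Finset.sum_induction _ (fun I : Ideal A => I ≤ Ideal.span ({t₁, v} : Set A) ^ μ)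
    (fun I J hI hJ => ?_) (by simp) fun e he => ?_)
  · rw [Ideal.add_eq_sup]; exact sup_le hI hJ
  · have he' : e ≤ μ := by simpa [Finset.mem_range, Nat.lt_succ_iff] using he
    exact (span_pow_mul_span_pow_le_span_pair_pow t₁ v e (k e)).trans (Ideal.pow_le_pow_right (hk e he'))

/-- The integer-weight instance: `d ≥ 2` and `J ⊆ Σ_e (t^e)·𝔪^{(μ−e)d}` ⟹ after one division the controlled transform lies in `(t₁, v)^μ` — the curve
`Z₀ = E ∩ L̃` lies in the order-`μ` locus («near»). [cite: CossartPiltant2008, Lemma 4.3 (4); Prop. 4.4 (proof, p. 11)] -/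
theorem pow_mul_mem_map_le_span_pair_pow (𝔪 : Ideal R) {t : R} {v t₁ : A} (hv : v ∈ nonZeroDivisors A)
    (h𝔪 : 𝔪.map ψ ≤ Ideal.span {v}) (ht : ψ t = v * t₁) (μ d : ℕ) (hd : 2 ≤ d) {J : Ideal R}
    (hJ : J ≤ ∑ e ∈ Finset.range (μ + 1), Ideal.span {t ^ e} * 𝔪 ^ ((μ - e) * d)) {x : A} (hx : v ^ μ * x ∈ J.map ψ) :
    x ∈ Ideal.span ({t₁, v} : Set A) ^ μ := by
  have hmem := mem_sum_of_pow_mul_mem_map_of_weight ψ 𝔪 hv h𝔪 ht μ d (by omega) hJ hx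
  refine le_span_pair_pow_of_le_sum (fun e => (μ - e) * (d - 1)) (fun e he => ?_) (le_refl _) hmem
  have h1 : (μ - e) * 1 ≤ (μ - e) * (d - 1) := Nat.mul_le_mul_left _ (by omega)
  rw [mul_one] at h1
  omega

end Summit.ResolutionOfSingularities.ResolutionOfSingularities.Theorems.RadicialJung.CleanModels

end
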